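import Mathlib.Analysis.Calculus.Deriv.Mul
import Mathlib.Analysis.Calculus.Deriv.Slope
import Mathlib.Analysis.Calculus.Deriv.Comp
import Mathlib.Analysis.SpecialFunctions.Trigonometric.Deriv
import Mathlib.Analysis.InnerProductSpace.PiL2
import Mathlib.Topology.Algebra.Module.FiniteDimension
import Literature.Geometry.Riemannian.MeanConvexSecondChainRule

/-!
# Mean convexity of an immersed round collar: the level-set criterion read through the
# parametrisation ("crease" form)

Topic `Geometry/Riemannian`; namespace `Literature.Geometry.Riemannian.SphereCollar`.  Everything
here is **proved**; no definitions, no named facts.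

Two idioms for "the hypersurface has positive mean curvature with respect to the normal pointing
into the domain it bounds" meet in the `SmoothPoincare4` routes: the LEVEL-SET idiom of the
Lawson–Michelsohn facts (`LawsonMichelsohn1984_surrounding`, `LawsonMichelsohn1984_meanConvexIsotopy_of_handles`:
a defining function `G` of the domain `{G ≤ 0}`, `dG ≠ 0`, and `0 < ∑ᵢ D²G(vᵢ, vᵢ)` for orthonormal
frames `v` of `ker dG`), and the PARAMETRISED idiom of immersed round collars
(`Ψ : E → E` a local diffeomorphism near the unit sphere, the domain being the image of the
exterior `{1 ≤ ‖x‖}`; mean convexity of the crease `Ψ(S)` at `Ψ u` towards `DΨ(u) u` reads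
`∑ᵢ ‖wᵢ‖² < ∑ᵢ ⟪DΨ(u)⁻¹ D²Ψ(u)(wᵢ, wᵢ), u⟫` for tangent frames `wᵢ ⊥ u` with `DΨ(u) wᵢ`
orthonormal — the predicate `CreaseMeanConvexAt` of route SymplecticOrigami's crux
`OrigamiFoldExistence`).  This file proves that the first implies the second
(`creaseMeanConvex_of_levelSet`), for `G = ρ ∘ τ` with `τ` a local inverse of `Ψ` at `u` and `ρ`
any `C²` function presenting the exterior, `{ρ ≤ 0} = {1 ≤ ‖x‖}` (so that `{G ≤ 0}` is the image
domain near `Ψ u`).  The computation: `dρ(u) = λ ⟪·, u⟫` with `λ < 0`, `D²ρ(u)(w, w) = λ ‖w‖²` on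
`u^⊥` (jets along great circles: `fderiv_eq_and_hessian_eq`, `fderiv_self_nonpos`), and the
second-order chain rule on `ρ = G ∘ Ψ` (`iteratedFDeriv_two_comp_apply`) give
`∑ᵢ D²G(DΨ wᵢ, DΨ wᵢ) = (-λ) · (∑ᵢ ⟪DΨ⁻¹ D²Ψ(wᵢ, wᵢ), u⟫ - ∑ᵢ ‖wᵢ‖²)`.

## References

* H. B. Lawson, Jr., M.-L. Michelsohn, *Embedding and surrounding with positive mean curvature*,
  Invent. Math. 77 (1984), §2 (2.4)–(2.6) (second fundamental form of a level hypersurface).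
  [LawsonMichelsohn1984]
* H. Cartan, *Calcul différentiel* (1967), Ch. I §5 (higher derivatives of a composite). [folklore]
-/

noncomputable section

open scoped Topology RealInnerProductSpace ContDiff
open Set Function Filter

namespace Literature.Geometry.Riemannian.SphereCollar

variable {E : Type*} [NormedAddCommGroup E] [InnerProductSpace ℝ E] {ρ : E → ℝ} {u : E}

/-! ### Jets along the unit sphere of a function presenting the exterior `{1 ≤ ‖x‖}` -/

/-- A continuous function with `{ρ ≤ 0} = {1 ≤ ‖x‖}` vanishes on the unit sphere (it is `> 0`
inside the ball). [folklore] -/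
theorem eq_zero_of_norm_eq_one (hρc : Continuous ρ) (hρS : ∀ x, ρ x ≤ 0 ↔ 1 ≤ ‖x‖) {x : E}
    (hx : ‖x‖ = 1) : ρ x = 0 := by
  refine le_antisymm ((hρS x).2 hx.ge) ?_
  have ht : Tendsto (fun t : ℝ => t • x) (𝓝[<] 1) (𝓝 x) := by
    have : Tendsto (fun t : ℝ => t • x) (𝓝 1) (𝓝 ((1 : ℝ) • x)) :=
      ((continuous_id.smul continuous_const).tendsto (1 : ℝ))
    rw [one_smul] at this
    exact this.mono_left nhdsWithin_le_nhds
  have hev : ∀ᶠ t in 𝓝[<] (1 : ℝ), 0 ≤ ρ (t • x) := by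
    have h0 : ∀ᶠ t in 𝓝[<] (1 : ℝ), (0 : ℝ) < t :=
      mem_nhdsWithin_of_mem_nhds (Ioi_mem_nhds (by norm_num : (0 : ℝ) < 1))
    filter_upwards [h0, self_mem_nhdsWithin] with t ht0 ht1
    have hlt : ‖t • x‖ < 1 := by
      rw [norm_smul, hx, mul_one, Real.norm_eq_abs, abs_of_pos ht0]; exact ht1
    by_contra h
    exact (not_le.2 hlt) ((hρS _).1 (not_le.1 h).le)
  exact ge_of_tendsto ((hρc.tendsto x).comp ht) hev

/-- The great circle `cos s • u + sin s • v` through the unit vector `u` with unit tangent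
`v ⊥ u` lies on the unit sphere. [folklore] -/
theorem norm_cos_smul_add_sin_smul (hu : ‖u‖ = 1) {v : E} (hv : ‖v‖ = 1) (huv : ⟪v, u⟫ = 0)
    (s : ℝ) : ‖Real.cos s • u + Real.sin s • v‖ = 1 := by
  have h2 : ‖Real.cos s • u + Real.sin s • v‖ ^ 2 = 1 := by
    rw [norm_add_sq_real, norm_smul, norm_smul, hu, hv, mul_one, mul_one, Real.norm_eq_abs,
      Real.norm_eq_abs, sq_abs, sq_abs, real_inner_smul_left, real_inner_smul_right,
      real_inner_comm, huv]
    simp [Real.cos_sq_add_sin_sq]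
  exact (pow_eq_one_iff_of_nonneg (norm_nonneg _) two_ne_zero).1 h2

/-- **First and second jet along the sphere, unit tangent direction**: if `ρ` is `C²` with
`{ρ ≤ 0} = {1 ≤ ‖x‖}`, `‖u‖ = 1` and `v ⊥ u` is a unit vector, then `dρ(u) v = 0` and
`D²ρ(u)(v, v) = dρ(u) u` (differentiate `ρ ∘ γ ≡ 0` twice along the great circle `γ`, whose
acceleration at `u` is `-u`). [folklore] -/
theorem fderiv_eq_zero_and_hessian_eq_of_unit (hρ : ContDiff ℝ 2 ρ)
    (hρS : ∀ x, ρ x ≤ 0 ↔ 1 ≤ ‖x‖) (hu : ‖u‖ = 1) {v : E} (hv : ‖v‖ = 1) (huv : ⟪v, u⟫ = 0) :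
    fderiv ℝ ρ u v = 0 ∧ iteratedFDeriv ℝ 2 ρ u ![v, v] = fderiv ℝ ρ u u := by
  -- the great circle and its derivatives
  set c : ℝ → E := fun s => Real.cos s • u + Real.sin s • v with hc
  set c' : ℝ → E := fun s => -Real.sin s • u + Real.cos s • v with hc'
  have hcd : ∀ s, HasDerivAt c (c' s) s := fun s =>
    ((Real.hasDerivAt_cos s).smul_const u).add ((Real.hasDerivAt_sin s).smul_const v)
  have hc'd : ∀ s, HasDerivAt c' (-Real.cos s • u + -Real.sin s • v) s := fun s =>
    ((Real.hasDerivAt_sin s).neg.smul_const u).add ((Real.hasDerivAt_cos s).smul_const v)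
  have hc0 : c 0 = u := by simp [hc]
  have hc'0 : c' 0 = v := by simp [hc']
  have hρd : ∀ x, HasFDerivAt ρ (fderiv ℝ ρ x) x := fun x =>
    (hρ.differentiable (by norm_num) x).hasFDerivAt
  -- `ρ ∘ c = 0`
  have hzero : ∀ s, ρ (c s) = 0 := fun s =>
    eq_zero_of_norm_eq_one hρ.continuous hρS (norm_cos_smul_add_sin_smul hu hv huv s)
  -- first derivative: `dρ(c s)(c' s) = 0` for all `s`
  have hk : ∀ s, fderiv ℝ ρ (c s) (c' s) = 0 := fun s => by
    have h1 : HasDerivAt (fun s => ρ (c s)) (fderiv ℝ ρ (c s) (c' s)) s :=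
      (hρd (c s)).comp_hasDerivAt s (hcd s)
    have h2 : HasDerivAt (fun s => ρ (c s)) 0 s := by
      have : (fun s => ρ (c s)) = fun _ => (0 : ℝ) := funext hzero
      rw [this]; exact hasDerivAt_const s 0
    exact h1.unique h2
  refine ⟨by simpa [hc0, hc'0] using hk 0, ?_⟩
  -- second derivative of `s ↦ dρ(c s)(c' s) ≡ 0` at `0`
  have hA : HasDerivAt (fun s => fderiv ℝ ρ (c s)) (fderiv ℝ (fderiv ℝ ρ) u v) 0 := by
    have hd2 : DifferentiableAt ℝ (fderiv ℝ ρ) u :=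
      ((hρ.contDiffAt (x := u)).fderiv_right (m := 1) le_rfl).differentiableAt one_ne_zero
    have := hd2.hasFDerivAt
    rw [← hc0] at this
    have h := this.comp_hasDerivAt (0 : ℝ) (hcd 0)
    rwa [hc'0, hc0] at h
  have hB : HasDerivAt c' (-u) 0 := by simpa using hc'd 0
  have hAB := hA.clm_apply hB
  have hzero' : HasDerivAt (fun s => fderiv ℝ ρ (c s) (c' s)) 0 0 := by
    have : (fun s => fderiv ℝ ρ (c s) (c' s)) = fun _ => (0 : ℝ) := funext hk
    rw [this]; exact hasDerivAt_const 0 0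
  have h := hAB.unique hzero'
  rw [hc'0, hc0, map_neg] at h
  rw [iteratedFDeriv_two_apply]
  simp only [Matrix.cons_val_zero, Matrix.cons_val_one]
  linarith

/-- **The `2`-jet of a function presenting the exterior of the unit ball, at a point of the
sphere**: `dρ(u) = λ ⟪·, u⟫` with `λ = dρ(u) u`, and `D²ρ(u)(w, w) = λ ‖w‖²` for every `w ⊥ u`.
[folklore] -/
theorem fderiv_eq_and_hessian_eq (hρ : ContDiff ℝ 2 ρ) (hρS : ∀ x, ρ x ≤ 0 ↔ 1 ≤ ‖x‖)
    (hu : ‖u‖ = 1) :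
    (∀ x, fderiv ℝ ρ u x = fderiv ℝ ρ u u * ⟪x, u⟫) ∧
    ∀ w, ⟪w, u⟫ = 0 → iteratedFDeriv ℝ 2 ρ u ![w, w] = fderiv ℝ ρ u u * ‖w‖ ^ 2 := by
  have hperp : ∀ w, ⟪w, u⟫ = 0 → fderiv ℝ ρ u w = 0 ∧
      iteratedFDeriv ℝ 2 ρ u ![w, w] = fderiv ℝ ρ u u * ‖w‖ ^ 2 := by
    intro w hw
    by_cases hw0 : w = 0
    · subst hw0
      simp only [map_zero, norm_zero, true_and]
      rw [iteratedFDeriv_two_apply]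
      simp
    · have hn : ‖w‖ ≠ 0 := norm_ne_zero_iff.2 hw0
      obtain ⟨v, hwv, hvn, hvu⟩ : ∃ v : E, w = ‖w‖ • v ∧ ‖v‖ = 1 ∧ ⟪v, u⟫ = 0 :=
        ⟨‖w‖⁻¹ • w, by rw [smul_smul, mul_inv_cancel₀ hn, one_smul],
          by rw [norm_smul, norm_inv, norm_norm, inv_mul_cancel₀ hn],
          by rw [real_inner_smul_left, hw, mul_zero]⟩
      obtain ⟨h1, h2⟩ := fderiv_eq_zero_and_hessian_eq_of_unit hρ hρS hu hvn hvu
      rw [iteratedFDeriv_two_apply] at h2 ⊢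
      simp only [Matrix.cons_val_zero, Matrix.cons_val_one] at h2 ⊢
      rw [hwv]
      simp only [map_smul, FunLike.coe_smul, Pi.smul_apply, smul_eq_mul, norm_smul,
        norm_norm, hvn, mul_one, h1, h2, mul_zero, true_and]
      ring
  refine ⟨fun x => ?_, fun w hw => (hperp w hw).2⟩
  have hu2 : ⟪u, u⟫ = 1 := by rw [real_inner_self_eq_norm_sq, hu, one_pow]
  have hx : x = ⟪x, u⟫ • u + (x - ⟪x, u⟫ • u) := by abel
  have hperp' : ⟪x - ⟪x, u⟫ • u, u⟫ = 0 := by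
    rw [inner_sub_left, real_inner_smul_left, hu2, mul_one, sub_self]
  conv_lhs => rw [hx]
  rw [map_add, map_smul, (hperp _ hperp').1, add_zero, smul_eq_mul, mul_comm]

/-- The normal derivative `λ = dρ(u) u` of a function presenting the exterior of the unit ball is
nonpositive at a point of the sphere (`ρ > 0` inside the ball and `ρ u = 0`). [folklore] -/
theorem fderiv_self_nonpos (hρ : ContDiff ℝ 2 ρ) (hρS : ∀ x, ρ x ≤ 0 ↔ 1 ≤ ‖x‖)
    (hu : ‖u‖ = 1) : fderiv ℝ ρ u u ≤ 0 := by
  set k : ℝ → ℝ := fun t => ρ (t • u) with hk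
  have hku : HasDerivAt k (fderiv ℝ ρ u u) 1 := by
    have h1 : HasDerivAt (fun t : ℝ => t • u) ((1 : ℝ) • u) 1 := (hasDerivAt_id (1 : ℝ)).smul_const u
    rw [one_smul] at h1
    have h2 : HasFDerivAt ρ (fderiv ℝ ρ u) ((1 : ℝ) • u) := by
      rw [one_smul]; exact (hρ.differentiable (by norm_num) u).hasFDerivAt
    exact h2.comp_hasDerivAt (1 : ℝ) h1
  have ht : Tendsto (slope k 1) (𝓝[<] 1) (𝓝 (fderiv ℝ ρ u u)) :=
    (hasDerivAt_iff_tendsto_slope.1 hku).mono_left (nhdsWithin_mono _ fun t ht => ne_of_lt ht)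
  have k1 : k 1 = 0 := by
    simp only [hk, one_smul]; exact eq_zero_of_norm_eq_one hρ.continuous hρS hu
  have hev : ∀ᶠ t in 𝓝[<] (1 : ℝ), slope k 1 t ≤ 0 := by
    have h0 : ∀ᶠ t in 𝓝[<] (1 : ℝ), (0 : ℝ) < t :=
      mem_nhdsWithin_of_mem_nhds (Ioi_mem_nhds (by norm_num : (0 : ℝ) < 1))
    filter_upwards [h0, self_mem_nhdsWithin] with t ht0 ht1
    have hlt : ‖t • u‖ < 1 := by
      rw [norm_smul, hu, mul_one, Real.norm_eq_abs, abs_of_pos ht0]; exact ht1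
    have hpos : 0 < k t := by
      by_contra h
      exact (not_le.2 hlt) ((hρS _).1 (not_lt.1 h))
    rw [slope_def_field, k1, sub_zero]
    exact (div_neg_of_pos_of_neg hpos (sub_neg.2 ht1)).le
  exact le_of_tendsto ht hev

/-! ### The level-set criterion implies the crease inequality -/

/-- **Level-set mean convexity, read in the chart given by the collar map, implies the crease
inequality.**  Let `Ψ : E → E` be `C²` at the unit vector `u` with a `C²` local inverse `τ` at
`Ψ u` (`τ ∘ Ψ = id` near `u`), let `ρ` be `C²` with `{ρ ≤ 0} = {1 ≤ ‖x‖}`, and put `G = ρ ∘ τ`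
(a defining function of the image of the exterior near `Ψ u`).  If `dG(Ψ u) ≠ 0` and
`0 < ∑ᵢ D²G(Ψ u)(vᵢ, vᵢ)` for every orthonormal family `v` in `ker dG(Ψ u)` (mean convexity of
`{G = 0}` towards `{G ≤ 0}`, outer normal `∇G`, as in the Lawson–Michelsohn facts), then for every
family `w` with `wᵢ ⊥ u` and `DΨ(u) wᵢ` orthonormal,
`∑ᵢ ‖wᵢ‖² < ∑ᵢ ⟪DΨ(u)⁻¹ (D²Ψ(u)(wᵢ, wᵢ)), u⟫` — the crease of the collar `Ψ` is mean convex at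
`u` towards `DΨ(u) u` (the body of `CreaseMeanConvexAt Ψ u` of crux `OrigamiFoldExistence`, route
SymplecticOrigami of `SmoothPoincare4`, with `Fin 3`-indexed frames in `ℝ⁴`). [folklore] -/
theorem creaseMeanConvex_of_levelSet [FiniteDimensional ℝ E] {ι : Type*} [Fintype ι]
    {Ψ τ : E → E} (hu : ‖u‖ = 1) (hΨ : ContDiffAt ℝ 2 Ψ u) (hτ : ContDiffAt ℝ 2 τ (Ψ u))
    (hτΨ : ∀ᶠ x in 𝓝 u, τ (Ψ x) = x)
    (hρ : ContDiff ℝ 2 ρ) (hρS : ∀ x, ρ x ≤ 0 ↔ 1 ≤ ‖x‖)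
    (hG : fderiv ℝ (ρ ∘ τ) (Ψ u) ≠ 0)
    (hmc : ∀ v : ι → E, Orthonormal ℝ v → (∀ i, fderiv ℝ (ρ ∘ τ) (Ψ u) (v i) = 0) →
      0 < ∑ i, iteratedFDeriv ℝ 2 (ρ ∘ τ) (Ψ u) ![v i, v i])
    (w : ι → E) (hw : ∀ i, ⟪w i, u⟫ = 0)
    (hon : Orthonormal ℝ (fun i => fderiv ℝ Ψ u (w i))) :
    ∑ i, ‖w i‖ ^ 2 <
      ∑ i, ⟪(fderiv ℝ Ψ u).inverse (fderiv ℝ (fun x => fderiv ℝ Ψ x (w i)) u (w i)), u⟫ := by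
  -- the second derivative in the crease form is the iterated derivative
  have hd2Ψ : DifferentiableAt ℝ (fderiv ℝ Ψ) u :=
    (hΨ.fderiv_right (m := 1) le_rfl).differentiableAt one_ne_zero
  have hclm : ∀ i, fderiv ℝ (fun x => fderiv ℝ Ψ x (w i)) u (w i) =
      iteratedFDeriv ℝ 2 Ψ u ![w i, w i] := fun i => by
    rw [fderiv_clm_apply hd2Ψ (differentiableAt_const _)]
    simp [iteratedFDeriv_two_apply]
  simp_rw [hclm]
  -- notation
  set L : E →L[ℝ] E := fderiv ℝ Ψ u with hL
  set p : E := Ψ u with hp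
  set G : E → ℝ := ρ ∘ τ with hGdef
  have hGd : ContDiffAt ℝ 2 G p := hρ.contDiffAt.comp p hτ
  have hΨd : DifferentiableAt ℝ Ψ u := hΨ.differentiableAt (by norm_num)
  have hτd : DifferentiableAt ℝ τ p := hτ.differentiableAt (by norm_num)
  have hGdiff : DifferentiableAt ℝ G p := hGd.differentiableAt (by norm_num)
  -- `ρ = G ∘ Ψ` near `u`
  have heq : (G ∘ Ψ) =ᶠ[𝓝 u] ρ := hτΨ.mono fun x hx => by
    show ρ (τ (Ψ x)) = ρ x
    rw [hx]
  -- first derivative: `dρ(u) = dG(p) ∘ L`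
  have hℓ : fderiv ℝ ρ u = (fderiv ℝ G p).comp L := by
    rw [← heq.fderiv_eq]; exact fderiv_comp u hGdiff hΨd
  -- `Dτ(p) ∘ L = id`, so `L` is bijective
  have hTL : ∀ x, fderiv ℝ τ p (L x) = x := by
    intro x
    have h1 : fderiv ℝ (τ ∘ Ψ) u = (fderiv ℝ τ p).comp L := fderiv_comp u hτd hΨd
    have h2 : fderiv ℝ (τ ∘ Ψ) u = ContinuousLinearMap.id ℝ E := by
      have : (τ ∘ Ψ) =ᶠ[𝓝 u] id := hτΨ
      rw [this.fderiv_eq, fderiv_id]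
    have := congrArg (fun f : E →L[ℝ] E => f x) (h1.symm.trans h2)
    simpa using this
  have hbij : Function.Bijective L := by
    have hinj : Function.Injective L := fun a b hab => by
      have := congrArg (fderiv ℝ τ p) hab
      rwa [hTL, hTL] at this
    exact ⟨hinj, (LinearMap.injective_iff_surjective (f := L.toLinearMap)).1 hinj⟩
  set Le : E ≃L[ℝ] E := (LinearEquiv.ofBijective L.toLinearMap hbij).toContinuousLinearEquiv
    with hLe
  have hLe' : ∀ x, Le x = L x := fun x => rfl
  have hLeL : (Le : E →L[ℝ] E) = L := ContinuousLinearMap.ext hLe'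
  have hinv : L.inverse = (Le.symm : E →L[ℝ] E) := by
    rw [← hLeL]; exact ContinuousLinearMap.inverse_equiv Le
  -- `dG(p) z = dρ(u) (Le⁻¹ z)`
  have hGz : ∀ z, fderiv ℝ G p z = fderiv ℝ ρ u (Le.symm z) := fun z => by
    rw [hℓ, ContinuousLinearMap.comp_apply, ← hLe', ContinuousLinearEquiv.apply_symm_apply]
  -- the sphere jet of `ρ`
  obtain ⟨hlin, hhess⟩ := fderiv_eq_and_hessian_eq hρ hρS hu
  have hlam_neg : fderiv ℝ ρ u u < 0 := by
    refine lt_of_le_of_ne (fderiv_self_nonpos hρ hρS hu) fun h0 => hG ?_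
    ext z
    rw [hGz, hlin (Le.symm z), h0, zero_mul]
    rfl
  -- the frame `L ∘ w` is orthonormal and tangent to `{G = 0}`
  have hv0 : ∀ i, fderiv ℝ G p (L (w i)) = 0 := fun i => by
    rw [hGz, ← hLe', ContinuousLinearEquiv.symm_apply_apply, hlin, hw i, mul_zero]
  have hpos := hmc (fun i => L (w i)) hon hv0
  -- second-order chain rule on `ρ = G ∘ Ψ` at `u`
  have hsecond : ∀ i, iteratedFDeriv ℝ 2 G p ![L (w i), L (w i)] =
      fderiv ℝ ρ u u * ‖w i‖ ^ 2 -
        fderiv ℝ ρ u u * ⟪Le.symm (iteratedFDeriv ℝ 2 Ψ u ![w i, w i]), u⟫ := fun i => by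
    have h1 : iteratedFDeriv ℝ 2 ρ u ![w i, w i] = iteratedFDeriv ℝ 2 (G ∘ Ψ) u ![w i, w i] := by
      rw [(heq.iteratedFDeriv ℝ 2).eq_of_nhds]
    have h2 := Literature.Geometry.Riemannian.iteratedFDeriv_two_comp_apply hΨ hGd (w i) (w i)
    rw [← h1, hhess (w i) (hw i), ← hp, ← hL, hGz,
      hlin (Le.symm (iteratedFDeriv ℝ 2 Ψ u ![w i, w i])), mul_comm (fderiv ℝ ρ u u) ⟪_, u⟫] at h2
    linarith
  have hsum : ∑ i, iteratedFDeriv ℝ 2 G p ![L (w i), L (w i)] =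
      fderiv ℝ ρ u u * (∑ i, ‖w i‖ ^ 2 - ∑ i, ⟪Le.symm (iteratedFDeriv ℝ 2 Ψ u ![w i, w i]), u⟫) := by
    simp_rw [hsecond]
    rw [Finset.sum_sub_distrib, ← Finset.mul_sum, ← Finset.mul_sum, mul_sub]
  rw [hsum] at hpos
  have hdiff : ∑ i, ‖w i‖ ^ 2 - ∑ i, ⟪Le.symm (iteratedFDeriv ℝ 2 Ψ u ![w i, w i]), u⟫ < 0 := by
    rcases pos_and_pos_or_neg_and_neg_of_mul_pos hpos with ⟨h1, -⟩ | ⟨-, h2⟩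
    · exact absurd h1 (not_lt.2 hlam_neg.le)
    · exact h2
  rw [hinv]
  simp only [ContinuousLinearEquiv.coe_coe]
  linarith

end Literature.Geometry.Riemannian.SphereCollar

end
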